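import Literature.NumberTheory.Weil1964.ArchMetaplecticDoubleCover
import HarnessLib

/-!
# Folland's complex blocks `P`, `Q` of `𝒜_c = 𝒲𝒜𝒲⁻¹` are multiplicative: `P(gh) = P_g P_h + Q_g Q̄_h`,
# `Q(gh) = P_g Q_h + Q_g P̄_h` (block identity G3 of Thm. (4.37)) — kernel, 0 cited facts

Topic `NumberTheory/Weil1964`; namespace `Literature.NumberTheory.Weil1964`.  Companion to
`Literature.NumberTheory.Weil1964.ArchMetaplecticDoubleCover` (row B07-1 of the pub-hodgecm2 literature fan-out:
the skeleton of Folland's Theorem (4.37) with the block `Sp.follandP` and the records R1, R2), supplying the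
ALGEBRAIC input "G3" that the skeleton's module docstring and `run/shared/lean/pub/pub-hodgecm2/lit/audit-B07.md` §2
list as "not typed (pure algebra; needed by the prover of R2)": the second complex block `Q` of

  `𝒜_c = 𝒲 𝒜 𝒲⁻¹ = (P Q; Q̄ P̄)`,  `𝒜 = (A B; C D) ∈ Sp(W)`,  `P = ½((A + D) + i(C − B))`,  `Q = ½((A − D) + i(B + C))`

(Folland (4.11)–(4.16), complex coordinate `z = p + iq`: `z ↦ P z + Q z̄`), and the two block identities expressing
that `𝒜 ↦ 𝒜_c` is multiplicative,

  `P(𝒜₁𝒜₂) = P₁ P₂ + Q₁ Q̄₂`,   `Q(𝒜₁𝒜₂) = P₁ Q₂ + Q₁ P̄₂`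

(`Q̄`, `P̄` = ENTRYWISE complex conjugates, `Matrix.map _ conj`).  The first is the sentence of the proof of
Thm. (4.37)(c), p. 161 L10: «`P₁P₂ + Q₁Q̄₂` is the upper left entry of `𝒜₁𝒜₂`».  Everything is PROVED from the
definitions of the skeleton (`Sp.blockA/B/C/D`, `Sp.follandP`); nothing is cited as a hypothesis, no `sorry`.

Contents:
* §1 the action of `g ∈ Sp(W)` in blocks (`Sp.apply_eq_blocks`) and the blocks of a product
  (`Sp.blockA_mul` … `Sp.blockD_mul`: `A₁₂ = A₁A₂ + B₁C₂`, `B₁₂ = A₁B₂ + B₁D₂`, `C₁₂ = C₁A₂ + D₁C₂`,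
  `D₁₂ = C₁B₂ + D₁D₂`);
* §2 `Sp.follandQ` with `Q(1) = 0` and the convention checks on the generators the tree implements:
  `Q(realify u) = 0` (`u ∈ U(σ)`; with the skeleton's `P(realify u) = u` this is Folland's Prop. (4.39):
  `U(n) ∋ u ↦ (u 0; 0 ū)`), `Q(n(b)) = (i/2) b` (chirps), `Q(m(a, d)) = ½(a − d)` (Levi);
* §3 the block identities `Sp.follandP_mul`, `Sp.follandQ_mul` and their corollaries on left/right translation by
  `U(σ)`: `P(u g) = u P(g)`, `P(g u) = P(g) u`, `Q(u g) = u Q(g)`, `Q(g u) = Q(g) ū`, hence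
  `det P(u g u') = det u · det P(g) · det u'` (the form in which the metaplectic normalisation `C² det P = 1` is
  transported along the compact generators).

## References

* [Folland1989] G. B. Folland, *Harmonic Analysis in Phase Space*, Annals of Mathematics Studies 122, Princeton UP
  1989 (held text `book:folland1989-harmonic-analysis-phase-space`, chunk = printed page): §4.1 (4.11)–(4.17)
  p0152–p0153, Prop. (4.39) p0161; §4.2 proof of Thm. (4.37)(c) p0160 L44 – p0161 L12.
-/

set_option autoImplicit false

noncomputable section

open Complex
open scoped ComplexConjugate

namespace Literature.NumberTheory.Weil1964

open Literature.Analysis.SegalBargmann Literature.RepresentationTheory.HeisenbergGroup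

variable {σ : Type*} [Fintype σ] [DecidableEq σ]

local notation "PV" σ => (σ → ℝ) × (σ → ℝ)
local notation "SpR" σ => symplecticGroup (polar (dotPairing σ))

namespace Sp

/-! ## 1. The action of `Sp(W)` in blocks, and the blocks of a product -/

omit [DecidableEq σ] in
/-- `g (p, 0) = (A p, C p)`. [cite: Folland1989, §4.1 Prop. (4.1)] -/
theorem apply_inl (g : SpR σ) (p : σ → ℝ) :
    (g.1 : (PV σ) ≃ₗ[ℝ] PV σ) (p, 0) = (blockA g p, blockC g p) := rfl

omit [DecidableEq σ] in
/-- `g (0, q) = (B q, D q)`. [cite: Folland1989, §4.1 Prop. (4.1)] -/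
theorem apply_inr (g : SpR σ) (q : σ → ℝ) :
    (g.1 : (PV σ) ≃ₗ[ℝ] PV σ) (0, q) = (blockB g q, blockD g q) := rfl

omit [DecidableEq σ] in
/-- **`g = (A B; C D)`**: `g (p, q) = (A p + B q, C p + D q)`. [cite: Folland1989, §4.1 Prop. (4.1)] -/
theorem apply_eq_blocks (g : SpR σ) (p q : σ → ℝ) :
    (g.1 : (PV σ) ≃ₗ[ℝ] PV σ) (p, q) = (blockA g p + blockB g q, blockC g p + blockD g q) := by
  have h : ((p, q) : PV σ) = (p, 0) + (0, q) := by rw [Prod.mk_add_mk, add_zero, zero_add]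
  rw [h, map_add, apply_inl, apply_inr, Prod.mk_add_mk]

omit [DecidableEq σ] in
/-- `(g h) w = g (h w)` in `Sp(W)` (composition of the real-linear maps `𝒜₁`, `𝒜₂`). [cite: Folland1989, §4.1 Prop. (4.1), (4.16)] -/
theorem mul_apply (g h : SpR σ) (w : PV σ) :
    ((g * h).1 : (PV σ) ≃ₗ[ℝ] PV σ) w = (g.1 : (PV σ) ≃ₗ[ℝ] PV σ) ((h.1 : (PV σ) ≃ₗ[ℝ] PV σ) w) := rfl

omit [DecidableEq σ] in
/-- Block `A` of a product: `A₁₂ = A₁ A₂ + B₁ C₂`. [cite: Folland1989, §4.1 (4.11)–(4.16)] -/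
theorem blockA_mul (g h : SpR σ) : blockA (g * h) = blockA g ∘ₗ blockA h + blockB g ∘ₗ blockC h := by
  refine LinearMap.ext fun p => ?_
  rw [blockA_apply, Sp.mul_apply, apply_inl, apply_eq_blocks]
  rfl

omit [DecidableEq σ] in
/-- Block `B` of a product: `B₁₂ = A₁ B₂ + B₁ D₂`. [cite: Folland1989, §4.1 (4.11)–(4.16)] -/
theorem blockB_mul (g h : SpR σ) : blockB (g * h) = blockA g ∘ₗ blockB h + blockB g ∘ₗ blockD h := by
  refine LinearMap.ext fun q => ?_
  rw [blockB_apply, Sp.mul_apply, apply_inr, apply_eq_blocks]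
  rfl

omit [DecidableEq σ] in
/-- Block `C` of a product: `C₁₂ = C₁ A₂ + D₁ C₂`. [cite: Folland1989, §4.1 (4.11)–(4.16)] -/
theorem blockC_mul (g h : SpR σ) : blockC (g * h) = blockC g ∘ₗ blockA h + blockD g ∘ₗ blockC h := by
  refine LinearMap.ext fun p => ?_
  rw [blockC_apply, Sp.mul_apply, apply_inl, apply_eq_blocks]
  rfl

omit [DecidableEq σ] in
/-- Block `D` of a product: `D₁₂ = C₁ B₂ + D₁ D₂`. [cite: Folland1989, §4.1 (4.11)–(4.16)] -/
theorem blockD_mul (g h : SpR σ) : blockD (g * h) = blockC g ∘ₗ blockB h + blockD g ∘ₗ blockD h := by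
  refine LinearMap.ext fun q => ?_
  rw [blockD_apply, Sp.mul_apply, apply_inr, apply_eq_blocks]
  rfl

/-! ## 2. Folland's second complex block `Q` -/

/-- **Folland's block `Q` of `𝒜_c = 𝒲𝒜𝒲⁻¹ = (P Q; Q̄ P̄)`** for `𝒜 = (A B; C D) ∈ Sp(W)`:
`Q = ½((A − D) + i(B + C))` — in the complex coordinate `z = p + iq` the real-linear map `𝒜` reads
`z ↦ P z + Q z̄` (from (4.11)–(4.13): `𝒲 = 2^{-1/2}(I iI; I −iI)`; companion of the skeleton's `Sp.follandP`,
`P = ½((A + D) + i(C − B))`). [cite: Folland1989, §4.1 (4.11)–(4.16)] -/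
def follandQ (g : SpR σ) : Matrix σ σ ℂ :=
  (2 : ℂ)⁻¹ • (Complex.ofRealHom.mapMatrix (LinearMap.toMatrix' (blockA g - blockD g))
    + I • Complex.ofRealHom.mapMatrix (LinearMap.toMatrix' (blockB g + blockC g)))

/-- `Q(1) = 0` (`1_c = (1 0; 0 1)`). [cite: Folland1989, §4.1 (4.11)] -/
@[simp] theorem follandQ_one : follandQ (1 : SpR σ) = 0 := by
  have hA : blockA (1 : SpR σ) = LinearMap.id := rfl
  have hD : blockD (1 : SpR σ) = LinearMap.id := rfl
  have hB : blockB (1 : SpR σ) = 0 := by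
    refine LinearMap.ext fun q => ?_
    rfl
  have hC : blockC (1 : SpR σ) = 0 := by
    refine LinearMap.ext fun q => ?_
    rfl
  rw [follandQ, hA, hD, hB, hC, sub_self, add_zero, map_zero, map_zero, smul_zero, add_zero, smul_zero]

omit [Fintype σ] in
/-- `phasePt` of a basis vector in the `p`-slot: `z = p + iq` at `(e_j, 0)` is `e_j`. [folklore] -/
private theorem phasePt_single_fst' (j : σ) : phasePt (Pi.single j (1 : ℝ)) (0 : σ → ℝ) = Pi.single j (1 : ℂ) := by
  funext k
  rw [phasePt_apply, Pi.zero_apply, Complex.ofReal_zero, zero_mul, add_zero, Pi.single_apply, Pi.single_apply]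
  split_ifs <;> simp

omit [Fintype σ] in
/-- `phasePt` of a basis vector in the `q`-slot: `z = p + iq` at `(0, e_j)` is `i e_j`. [folklore] -/
private theorem phasePt_single_snd' (j : σ) : phasePt (0 : σ → ℝ) (Pi.single j (1 : ℝ)) = Pi.single j I := by
  funext k
  rw [phasePt_apply, Pi.zero_apply, Complex.ofReal_zero, zero_add, Pi.single_apply, Pi.single_apply]
  split_ifs <;> simp

/-- **Convention check on the compact generators: `Q(u) = 0` for `u ∈ U(σ) ⊂ Sp(W)`** (the tree's `realifySp u`),
i.e. with the skeleton's `P(u) = u`: `u_c = (u 0; 0 ū)` — Folland's embedding `U(n) ∋ P ↦ (P 0; 0 P̄) ∈ Sp_c` of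
Prop. (4.39) (a complex-LINEAR map has no `z̄`-part). [cite: Folland1989, §4.1 Prop. (4.6), §4.2 Prop. (4.39)] -/
@[simp] theorem follandQ_realifySp (u : Matrix.unitaryGroup σ ℂ) : follandQ (realifySp σ u) = 0 := by
  ext i j
  simp only [follandQ, Matrix.smul_apply, Matrix.add_apply, RingHom.mapMatrix_apply, Matrix.map_apply,
    LinearMap.toMatrix'_apply, LinearMap.add_apply, LinearMap.sub_apply, Pi.add_apply, Pi.sub_apply,
    blockA_apply, blockB_apply, blockC_apply, blockD_apply, coe_realifySp, realify, phasePt_single_fst',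
    phasePt_single_snd', Matrix.mulVec_single, Matrix.col_apply, Pi.smul_apply,
    MulOpposite.smul_eq_mul_unop, MulOpposite.unop_op, Complex.ofRealHom_eq_coe, smul_eq_mul, Complex.mul_I_re,
    Complex.mul_I_im, Complex.ofReal_add, Complex.ofReal_sub, Matrix.zero_apply]
  apply Complex.ext
  · simp
  · simp

/-- **Convention check on the Siegel unipotents: `Q(n(b)) = (i/2) b`** for `n(b) : (p, q) ↦ (p, q + bp)`
(`b` symmetric; Folland's `(I 0; C I)` with `C = b`, the chirps of (4.25)). [cite: Folland1989, §4.1 (4.11), §4.2 (4.25)] -/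
theorem follandQ_unipotentSp (b : (σ → ℝ) →ₗ[ℝ] (σ → ℝ)) (hb : ∀ x x', dotPairing σ x (b x') = dotPairing σ x' (b x)) :
    follandQ (unipotentSp (dotPairing σ) b hb) = ((2 : ℂ)⁻¹ * I) • Complex.ofRealHom.mapMatrix (LinearMap.toMatrix' b) := by
  ext i j
  simp only [follandQ, Matrix.smul_apply, Matrix.add_apply, RingHom.mapMatrix_apply, Matrix.map_apply,
    LinearMap.toMatrix'_apply, LinearMap.add_apply, LinearMap.sub_apply, Pi.add_apply, Pi.sub_apply,
    blockA_apply, blockB_apply, blockC_apply, blockD_apply, coe_unipotentSp, unipotentσ_apply, map_zero, add_zero,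
    Pi.zero_apply, zero_add, sub_self, Complex.ofRealHom_eq_coe, smul_eq_mul, mul_assoc]

/-- **Convention check on the Levi factor: `Q(m(a, d)) = ½ (a − d)`** for `m(a, d) : (p, q) ↦ (a p, d q)`, `d = a*⁻¹`
(Folland's `(A 0; 0 A*⁻¹)`, (4.24)). [cite: Folland1989, §4.1 (4.11), §4.2 (4.24)] -/
theorem follandQ_leviSp (a d : (σ → ℝ) ≃ₗ[ℝ] (σ → ℝ)) (had : ∀ x y, dotPairing σ (a x) (d y) = dotPairing σ x y) :
    follandQ (leviSp (dotPairing σ) a d had) =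
      (2 : ℂ)⁻¹ • Complex.ofRealHom.mapMatrix (LinearMap.toMatrix' (a.toLinearMap - d.toLinearMap)) := by
  ext i j
  simp only [follandQ, Matrix.smul_apply, Matrix.add_apply, RingHom.mapMatrix_apply, Matrix.map_apply,
    LinearMap.toMatrix'_apply, LinearMap.add_apply, LinearMap.sub_apply, Pi.add_apply, Pi.sub_apply,
    blockA_apply, blockB_apply, blockC_apply, blockD_apply, coe_leviSp_apply, map_zero, add_zero,
    Complex.ofRealHom_eq_coe, smul_eq_mul, LinearEquiv.coe_coe, Pi.zero_apply, mul_zero]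

/-! ## 3. The block identities `P(gh) = P_g P_h + Q_g Q̄_h`, `Q(gh) = P_g Q_h + Q_g P̄_h` -/

/-- Entry `(i, j)` of `P(g)`: `½((A + D)_{ij} + i (C − B)_{ij})`. [cite: Folland1989, §4.1 (4.16)] -/
theorem follandP_apply (g : SpR σ) (i j : σ) :
    follandP g i j = (2 : ℂ)⁻¹ * ((((LinearMap.toMatrix' (blockA g) i j : ℝ) : ℂ) + ((LinearMap.toMatrix' (blockD g) i j : ℝ) : ℂ))
      + I * (((LinearMap.toMatrix' (blockC g) i j : ℝ) : ℂ) - ((LinearMap.toMatrix' (blockB g) i j : ℝ) : ℂ))) := by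
  simp only [follandP, Matrix.smul_apply, Matrix.add_apply, RingHom.mapMatrix_apply, Matrix.map_apply, map_add,
    map_sub, Matrix.sub_apply, Complex.ofRealHom_eq_coe, smul_eq_mul]

/-- Entry `(i, j)` of `Q(g)`: `½((A − D)_{ij} + i (B + C)_{ij})`. [cite: Folland1989, §4.1 (4.16)] -/
theorem follandQ_apply (g : SpR σ) (i j : σ) :
    follandQ g i j = (2 : ℂ)⁻¹ * ((((LinearMap.toMatrix' (blockA g) i j : ℝ) : ℂ) - ((LinearMap.toMatrix' (blockD g) i j : ℝ) : ℂ))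
      + I * (((LinearMap.toMatrix' (blockB g) i j : ℝ) : ℂ) + ((LinearMap.toMatrix' (blockC g) i j : ℝ) : ℂ))) := by
  simp only [follandQ, Matrix.smul_apply, Matrix.add_apply, RingHom.mapMatrix_apply, Matrix.map_apply, map_add,
    map_sub, Matrix.sub_apply, Complex.ofRealHom_eq_coe, smul_eq_mul]

/-- **G3, first block identity — `P(𝒜₁𝒜₂) = P₁ P₂ + Q₁ Q̄₂`**: the upper-left block of `(𝒜₁𝒜₂)_c = (𝒜₁)_c (𝒜₂)_c`
(«`P₁P₂ + Q₁Q̄₂` is the upper left entry of `𝒜₁𝒜₂`», proof of Thm. (4.37)(c), p. 161 L10); `Q̄₂` is the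
entrywise conjugate. [cite: Folland1989, §4.1 (4.11)–(4.16); §4.2 Thm. (4.37)(c) proof, p. 161] -/
theorem follandP_mul (g h : SpR σ) :
    follandP (g * h) = follandP g * follandP h + follandQ g * (follandQ h).map conj := by
  ext i j
  rw [follandP_apply, blockA_mul, blockB_mul, blockC_mul, blockD_mul, Matrix.add_apply, Matrix.mul_apply,
    Matrix.mul_apply]
  simp only [map_add, map_sub, LinearMap.toMatrix'_comp, Matrix.add_apply, Matrix.mul_apply, Matrix.map_apply,
    follandP_apply, follandQ_apply, map_mul, map_inv₀, map_ofNat, Complex.conj_ofReal, Complex.conj_I]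
  push_cast
  simp only [Finset.mul_sum, ← Finset.sum_add_distrib, ← Finset.sum_sub_distrib]
  refine Finset.sum_congr rfl fun k _ => ?_
  have hI : I * I = -1 := Complex.I_mul_I
  linear_combination ((4 : ℂ)⁻¹ * (((LinearMap.toMatrix' (blockB g) i k : ℝ) : ℂ) + (LinearMap.toMatrix' (blockC g) i k : ℝ))
      * (((LinearMap.toMatrix' (blockB h) k j : ℝ) : ℂ) + (LinearMap.toMatrix' (blockC h) k j : ℝ))
    - (4 : ℂ)⁻¹ * (((LinearMap.toMatrix' (blockC g) i k : ℝ) : ℂ) - (LinearMap.toMatrix' (blockB g) i k : ℝ))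
      * (((LinearMap.toMatrix' (blockC h) k j : ℝ) : ℂ) - (LinearMap.toMatrix' (blockB h) k j : ℝ))) * hI

/-- **G3, second block identity — `Q(𝒜₁𝒜₂) = P₁ Q₂ + Q₁ P̄₂`**: the upper-right block of
`(𝒜₁𝒜₂)_c = (𝒜₁)_c (𝒜₂)_c`; `P̄₂` is the entrywise conjugate. [cite: Folland1989, §4.1 (4.11)–(4.16)] -/
theorem follandQ_mul (g h : SpR σ) :
    follandQ (g * h) = follandP g * follandQ h + follandQ g * (follandP h).map conj := by
  ext i j
  rw [follandQ_apply, blockA_mul, blockB_mul, blockC_mul, blockD_mul, Matrix.add_apply, Matrix.mul_apply,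
    Matrix.mul_apply]
  simp only [map_add, map_sub, LinearMap.toMatrix'_comp, Matrix.add_apply, Matrix.mul_apply, Matrix.map_apply,
    follandP_apply, follandQ_apply, map_mul, map_inv₀, map_ofNat, Complex.conj_ofReal, Complex.conj_I]
  push_cast
  simp only [Finset.mul_sum, ← Finset.sum_add_distrib, ← Finset.sum_sub_distrib]
  refine Finset.sum_congr rfl fun k _ => ?_
  have hI : I * I = -1 := Complex.I_mul_I
  linear_combination ((4 : ℂ)⁻¹ * (((LinearMap.toMatrix' (blockB g) i k : ℝ) : ℂ) + (LinearMap.toMatrix' (blockC g) i k : ℝ))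
      * (((LinearMap.toMatrix' (blockC h) k j : ℝ) : ℂ) - (LinearMap.toMatrix' (blockB h) k j : ℝ))
    - (4 : ℂ)⁻¹ * (((LinearMap.toMatrix' (blockC g) i k : ℝ) : ℂ) - (LinearMap.toMatrix' (blockB g) i k : ℝ))
      * (((LinearMap.toMatrix' (blockB h) k j : ℝ) : ℂ) + (LinearMap.toMatrix' (blockC h) k j : ℝ))) * hI

/-! ### Corollaries: translation by the compact generators `U(σ)` -/

/-- `P(u g) = u P(g)` for `u ∈ U(σ)`. [cite: Folland1989, §4.2 Prop. (4.39)] -/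
theorem follandP_realifySp_mul (u : Matrix.unitaryGroup σ ℂ) (g : SpR σ) :
    follandP (realifySp σ u * g) = (u : Matrix σ σ ℂ) * follandP g := by
  rw [follandP_mul, follandP_realifySp, follandQ_realifySp, zero_mul, add_zero]

/-- `Q(u g) = u Q(g)` for `u ∈ U(σ)`. [cite: Folland1989, §4.2 Prop. (4.39)] -/
theorem follandQ_realifySp_mul (u : Matrix.unitaryGroup σ ℂ) (g : SpR σ) :
    follandQ (realifySp σ u * g) = (u : Matrix σ σ ℂ) * follandQ g := by
  rw [follandQ_mul, follandP_realifySp, follandQ_realifySp, zero_mul, add_zero]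

/-- `P(g u) = P(g) u` for `u ∈ U(σ)`. [cite: Folland1989, §4.2 Prop. (4.39)] -/
theorem follandP_mul_realifySp (g : SpR σ) (u : Matrix.unitaryGroup σ ℂ) :
    follandP (g * realifySp σ u) = follandP g * (u : Matrix σ σ ℂ) := by
  rw [follandP_mul, follandP_realifySp, follandQ_realifySp, Matrix.map_zero _ (map_zero (starRingEnd ℂ)), mul_zero,
    add_zero]

/-- `Q(g u) = Q(g) ū` for `u ∈ U(σ)` (`ū` the entrywise conjugate). [cite: Folland1989, §4.2 Prop. (4.39)] -/
theorem follandQ_mul_realifySp (g : SpR σ) (u : Matrix.unitaryGroup σ ℂ) :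
    follandQ (g * realifySp σ u) = follandQ g * (u : Matrix σ σ ℂ).map conj := by
  rw [follandQ_mul, follandP_realifySp, follandQ_realifySp, mul_zero, zero_add]

/-- **`det P(u g u') = det u · det P(g) · det u'`** for `u, u' ∈ U(σ)`: the quantity `det P` normalising the
metaplectic phase (`C² det P = 1`) is bi-equivariant under the compact generators.
[cite: Folland1989, §4.2 (4.36)–(4.39)] -/
theorem det_follandP_realifySp_mul_mul_realifySp (u u' : Matrix.unitaryGroup σ ℂ) (g : SpR σ) :
    (follandP (realifySp σ u * g * realifySp σ u')).det =
      (u : Matrix σ σ ℂ).det * (follandP g).det * (u' : Matrix σ σ ℂ).det := by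
  rw [follandP_mul_realifySp, follandP_realifySp_mul, Matrix.det_mul, Matrix.det_mul]

end Sp

end Literature.NumberTheory.Weil1964
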